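import Summits.MatrixMultiplication.OmegaCensus.IndepSetSearch
import Mathlib.Algebra.BigOperators.Ring.Finset
import Mathlib.Algebra.Order.BigOperators.Group.Finset

/-!
# ω-census, family (b3): "no independent set of `k` vertices" — colour-class search and certificate trees for the kernel

HONEST FRAMING (pub-omega census; verbatim): lottery ticket; floor = certified bounds/negative ranges.
Census BOOKKEEPING machinery — two further Boolean checkers for the independence bounds behind `ProductBoxBound.box_bound`
(NR138 and its `Dic₃` sequel) and their soundness; no value of `ω` is touched here.  Continues `IndepSetSearch.lean` (same data
model: vertices are naturals, `adj a` is the bit mask of the flagged neighbours of `a`, candidate sets are masks, `IndepN adj I` is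
independence, first-fit clique partition `ffBlocks`).  Nothing here is specific to groups.

## Part 1 — colour-class branching (`mcq`)

`noIndep` of `IndepSetSearch` branches "first candidate in / out".  `mcq adj vs k P` instead uses the first-fit clique partition
`B₀, …, B_{m-1}` of the candidates twice: as the BOUND (`m < k` refutes a `k`-set) and for BRANCHING — an independent `k`-set meets every
block at most once, so it contains a vertex of one of the blocks `B_k, …, B_{m-1}`; the checker therefore only branches on the
vertices `v` of those top blocks (last block first), each time asking recursively for "no independent `(k-1)`-set among the remaining
candidates that are not flagged neighbours of `v`", and then discards `v` (the classical maximum-clique branching of Tomita et al.,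
named only; nothing from the literature enters a proof).

* `mcq` (with its loops `mcqV` over the vertices of one block and `mcqB` over the top blocks) and **`card_lt_of_mcq`**: if
  `mcq adj vs k P = true` then every `adj`-independent `I ⊆ {v ∈ vs | v ∈ P}` has `#I < k`; `card_lt_of_mcq_range` is the
  whole-range form.

## Part 2 — certificate trees (`Cert`)

Here the kernel only CHECKS a certificate found offline: a table `tab` of cliques (masks; `tabOK` verifies once that every listed
mask is a clique on vertices `< n`) and a tree `Cert` whose nodes are

* `cov L` — the candidates are covered by the table cliques with indices `L`, and `L.length < k`: an independent set meets a
  clique at most once (`IndepN.card_le_length`), so it has `< k` elements;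
* `fcov D L` — a FRACTIONAL clique cover: `L` lists (index, weight) pairs, every candidate vertex lies in cliques of total weight
  `≥ D`, and the total weight is `< k·D`; then `D·#I ≤ Σ_{a ∈ I} (weight at a) = Σ_cliques weight·#(I ∩ clique) ≤ total < k·D`;
* `br v cin cout` — branch on vertex `v`: an independent `k`-set either contains `v` (then `k-1` further members among the
  non-neighbours: certificate `cin`) or avoids it (`cout`);
* `auto` — hand the (small) remaining instance to the colour-class search `mcq` of Part 1.

**`Cert.sound`**: if `tabOK adj tab m n = true` and `c.check adj tab m vs P k = true` then every `adj`-independent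
`I ⊆ {v ∈ vs | v ∈ P}` has `#I < k`.  Instances (the `Dic₃` boxes of the census, constant `α_{Dic₃}(12,3,3) = 20`) live in
`Dic3Box*.lean`.
-/

open Finset

namespace Summit.MatrixMultiplication.OmegaCensus.IndepSearch

/-! ## Part 1: the colour-class checker -/

/-- Loop over the listed vertices of block `B` that are still candidates: for each such `v`, the recursive check `rec` must refute a
`(k-1)`-set among the non-neighbours of `v`, after which `v` is discarded.  Returns the verdict and the remaining candidates. [folklore] -/
def mcqV (adj : ℕ → ℕ) (rec : ℕ → Bool) (B : ℕ) : List ℕ → ℕ → Bool × ℕ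
  | [], P => (true, P)
  | v :: rest, P =>
      if B.testBit v && P.testBit v then
        if rec ((P.ldiff (adj v)).ldiff (2 ^ v)) then mcqV adj rec B rest (P.ldiff (2 ^ v)) else (false, P)
      else mcqV adj rec B rest P

/-- Loop over the top blocks (given last block first). [folklore] -/
def mcqB (adj : ℕ → ℕ) (rec : ℕ → Bool) (vs : List ℕ) : List ℕ → ℕ → Bool
  | [], _ => true
  | B :: Bs, P => (mcqV adj rec B vs P).1 && mcqB adj rec vs Bs (mcqV adj rec B vs P).2

/-- **The checker.** `mcq adj vs k P = true` certifies: no `adj`-independent set of `k` listed vertices inside the mask `P`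
(`card_lt_of_mcq`). [folklore] -/
def mcq (adj : ℕ → ℕ) (vs : List ℕ) : ℕ → ℕ → Bool
  | 0, _ => false
  | k + 1, P =>
      let blocks := ffBlocks adj P vs []
      if blocks.length ≤ k then true else mcqB adj (mcq adj vs k) vs ((blocks.drop k).reverse) P

/-! ## Soundness -/

section Sound

variable {adj : ℕ → ℕ} {vs : List ℕ} {k : ℕ}

/-- Bits outside `B` are untouched by the vertex loop. [folklore] -/
theorem mcqV_testBit_of_not (rec : ℕ → Bool) (B : ℕ) :
    ∀ (l : List ℕ) (P : ℕ) (u : ℕ), B.testBit u = false → (mcqV adj rec B l P).2.testBit u = P.testBit u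
  | [], _, _, _ => rfl
  | v :: rest, P, u, hu => by
      simp only [mcqV]
      split_ifs with h1 h2
      · rw [mcqV_testBit_of_not rec B rest _ u hu, Nat.testBit_ldiff, Nat.testBit_two_pow]
        have : v ≠ u := by rintro rfl; simp only [Bool.and_eq_true] at h1; rw [h1.1] at hu; exact Bool.noConfusion hu
        simp [this]
      · rfl
      · exact mcqV_testBit_of_not rec B rest P u hu

/-- The remaining candidates only shrink. [folklore] -/
theorem mcqV_testBit_imp (rec : ℕ → Bool) (B : ℕ) :
    ∀ (l : List ℕ) (P : ℕ) (u : ℕ), (mcqV adj rec B l P).2.testBit u = true → P.testBit u = true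
  | [], _, _, h => h
  | v :: rest, P, u, h => by
      simp only [mcqV] at h
      split_ifs at h with h1 h2
      · have := mcqV_testBit_imp rec B rest _ u h
        rw [Nat.testBit_ldiff] at this
        simp only [Bool.and_eq_true] at this
        exact this.1
      · exact h
      · exact mcqV_testBit_imp rec B rest P u h

/-- Soundness of the vertex loop: if it passes and `rec` refutes `k`-sets, then every independent `I` inside `P` (listed vertices) that
contains a vertex `u` of `B` still ahead in the loop has fewer than `k + 1` elements. [folklore] -/
theorem mcqV_sound (rec : ℕ → Bool)
    (hrec : ∀ Q, rec Q = true → ∀ J : Finset ℕ, IndepN adj J → (∀ a ∈ J, a ∈ vs ∧ Q.testBit a = true) → J.card < k) (B : ℕ) :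
    ∀ (l : List ℕ) (P : ℕ), (mcqV adj rec B l P).1 = true →
      ∀ I : Finset ℕ, IndepN adj I → (∀ a ∈ I, a ∈ vs ∧ P.testBit a = true) →
        (∃ u ∈ I, u ∈ l ∧ B.testBit u = true) → I.card < k + 1
  | [], _, _, I, _, _, ⟨u, _, hu, _⟩ => by simp at hu
  | v :: rest, P, h, I, hI, hsub, ⟨u, huI, hul, huB⟩ => by
      classical
      simp only [mcqV] at h
      by_cases h1 : (B.testBit v && P.testBit v) = true
      · rw [if_pos h1] at h
        by_cases h2 : rec ((P.ldiff (adj v)).ldiff (2 ^ v)) = true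
        · -- `v ∈ B ∩ P`, the recursive check passed, the loop went on with `P \ {v}`
          rw [if_pos h2] at h
          by_cases hvI : v ∈ I
          · have hJ := hrec _ h2 (I.erase v) (fun a ha b hb hab =>
              hI a (Finset.mem_of_mem_erase ha) b (Finset.mem_of_mem_erase hb) hab) fun a ha => by
              have hav : a ≠ v := Finset.ne_of_mem_erase ha
              have haI := Finset.mem_of_mem_erase ha
              refine ⟨(hsub a haI).1, ?_⟩
              rw [Nat.testBit_ldiff, Nat.testBit_ldiff, Nat.testBit_two_pow, (hsub a haI).2, hI v hvI a haI (Ne.symm hav)]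
              simp [Ne.symm hav]
            have := Finset.card_erase_add_one hvI
            omega
          · have huv : u ≠ v := fun e => hvI (e ▸ huI)
            refine mcqV_sound rec hrec B rest _ h I hI (fun a ha => ⟨(hsub a ha).1, ?_⟩)
              ⟨u, huI, (List.mem_cons.1 hul).resolve_left huv, huB⟩
            have hav : a ≠ v := fun e => hvI (e ▸ ha)
            rw [Nat.testBit_ldiff, Nat.testBit_two_pow, (hsub a ha).2]
            simp [Ne.symm hav]
        · rw [if_neg h2] at h
          exact absurd h Bool.false_ne_true
      · -- `v` skipped
        rw [if_neg h1] at h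
        have huv : u ≠ v := by
          rintro rfl
          simp only [Bool.and_eq_true, not_and] at h1
          exact h1 huB (hsub u huI).2
        exact mcqV_sound rec hrec B rest P h I hI hsub ⟨u, huI, (List.mem_cons.1 hul).resolve_left huv, huB⟩

/-- Soundness of the block loop: if it passes, every independent `I` inside `P` (listed vertices) meeting one of the blocks `Bs` has fewer
than `k + 1` elements. [folklore] -/
theorem mcqB_sound (rec : ℕ → Bool)
    (hrec : ∀ Q, rec Q = true → ∀ J : Finset ℕ, IndepN adj J → (∀ a ∈ J, a ∈ vs ∧ Q.testBit a = true) → J.card < k) :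
    ∀ (Bs : List ℕ) (P : ℕ), mcqB adj rec vs Bs P = true →
      ∀ I : Finset ℕ, IndepN adj I → (∀ a ∈ I, a ∈ vs ∧ P.testBit a = true) →
        (∃ u ∈ I, ∃ B ∈ Bs, B.testBit u = true) → I.card < k + 1
  | [], _, _, I, _, _, ⟨u, _, B, hB, _⟩ => by simp at hB
  | B :: Bs, P, h, I, hI, hsub, ⟨u, huI, B', hB', huB'⟩ => by
      simp only [mcqB, Bool.and_eq_true] at h
      by_cases hmeet : ∃ w ∈ I, B.testBit w = true
      · obtain ⟨w, hwI, hwB⟩ := hmeet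
        exact mcqV_sound rec hrec B vs P h.1 I hI hsub ⟨w, hwI, (hsub w hwI).1, hwB⟩
      · -- `I` misses `B`: it survives into the remaining candidates
        have hB'mem : B' ∈ Bs := by
          rcases List.mem_cons.1 hB' with rfl | h'
          · exact absurd ⟨u, huI, huB'⟩ hmeet
          · exact h'
        refine mcqB_sound rec hrec Bs _ h.2 I hI (fun a ha => ⟨(hsub a ha).1, ?_⟩) ⟨u, huI, B', hB'mem, huB'⟩
        have haB : B.testBit a = false := by
          cases e : B.testBit a
          · rfl
          · exact absurd ⟨a, ha, e⟩ hmeet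
        rw [mcqV_testBit_of_not rec B vs P a haB]
        exact (hsub a ha).2

/-- **Soundness.** If `mcq adj vs k P = true` then every `adj`-independent set of listed vertices inside `P` has fewer than `k` elements.
[folklore] -/
theorem card_lt_of_mcq (adj : ℕ → ℕ) (vs : List ℕ) :
    ∀ (k P : ℕ), mcq adj vs k P = true → ∀ I : Finset ℕ, IndepN adj I → (∀ a ∈ I, a ∈ vs ∧ P.testBit a = true) → I.card < k
  | 0, _, h, _, _, _ => by simp [mcq] at h
  | k + 1, P, h, I, hI, hsub => by
      classical
      simp only [mcq] at h
      -- the blocks cover `I` and are weak cliques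
      have hcl := ffBlocks_clique adj P vs [] (by simp)
      have hcov : ∀ a ∈ I, ∃ B ∈ ffBlocks adj P vs [], B.testBit a = true := fun a ha =>
        ffBlocks_cover adj P vs [] a (Or.inl (hsub a ha))
      split_ifs at h with hlen
      · exact lt_of_le_of_lt (hI.card_le_length _ hcl hcov) (Nat.lt_succ_of_le hlen)
      · by_cases htop : ∃ u ∈ I, ∃ B ∈ ((ffBlocks adj P vs []).drop k).reverse, B.testBit u = true
        · exact mcqB_sound (mcq adj vs k) (fun Q hQ J hJ hJs => card_lt_of_mcq adj vs k Q hQ J hJ hJs) _ P h I hI hsub htop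
        · -- `I` lies in the first `k` blocks
          have hcov' : ∀ a ∈ I, ∃ B ∈ (ffBlocks adj P vs []).take k, B.testBit a = true := by
            intro a ha
            obtain ⟨B, hB, hBa⟩ := hcov a ha
            rw [← List.take_append_drop k (ffBlocks adj P vs []), List.mem_append] at hB
            rcases hB with hB | hB
            · exact ⟨B, hB, hBa⟩
            · exact absurd ⟨a, ha, B, List.mem_reverse.2 hB, hBa⟩ htop
          have hle := hI.card_le_length _ (fun B hB => hcl B (List.mem_of_mem_take hB)) hcov'
          have := List.length_take_le k (ffBlocks adj P vs [])
          omega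

/-- **Corollary (whole vertex range).** If `mcq adj (List.range n) k (2 ^ n - 1) = true`, every `adj`-independent `I ⊆ range n` has
`#I < k`. [folklore] -/
theorem card_lt_of_mcq_range {adj : ℕ → ℕ} {n k : ℕ} (h : mcq adj (List.range n) k (2 ^ n - 1) = true)
    (I : Finset ℕ) (hI : IndepN adj I) (hIn : ∀ a ∈ I, a < n) : I.card < k :=
  card_lt_of_mcq adj _ k _ h I hI fun a ha =>
    ⟨List.mem_range.2 (hIn a ha), by rw [Nat.testBit_two_pow_sub_one]; simpa using hIn a ha⟩

end Sound



/-! ## Part 2: certificates and their checker -/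

/-- Certificate tree for "no independent `k`-set among the candidates" (see the module doc-string). [folklore] -/
inductive Cert where
  /-- integer clique cover: indices into the clique table -/
  | cov : List ℕ → Cert
  /-- fractional clique cover: threshold `D` and (index, weight) pairs -/
  | fcov : ℕ → List (ℕ × ℕ) → Cert
  /-- branch on a vertex: `v` in the set / `v` not in the set -/
  | br : ℕ → Cert → Cert → Cert
  /-- run the colour-class search `mcq` -/
  | auto : Cert

/-- Union of the table cliques with the listed indices. [folklore] -/
def covMask (tab : ℕ → ℕ) : List ℕ → ℕ
  | [] => 0
  | i :: L => tab i ||| covMask tab L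

/-- Total weight of the listed (index, weight) pairs whose clique contains `v`. [folklore] -/
def wdeg (tab : ℕ → ℕ) (v : ℕ) : List (ℕ × ℕ) → ℕ
  | [] => 0
  | iw :: L => (if (tab iw.1).testBit v then iw.2 else 0) + wdeg tab v L

/-- Total weight of the listed (index, weight) pairs. [folklore] -/
def wsum : List (ℕ × ℕ) → ℕ
  | [] => 0
  | iw :: L => iw.2 + wsum L

/-- The clique table is sound: every `tab i` (`i < m`) is a mask on vertices `< n` all of whose members are pairwise flagged
adjacent (each member's mask lies inside the closed neighbourhood of every member `a < n`). [folklore] -/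
def tabOK (adj tab : ℕ → ℕ) (m n : ℕ) : Bool :=
  (List.range m).all fun i =>
    decide (tab i < 2 ^ n) && (List.range n).all fun a => !(tab i).testBit a || ((tab i) &&& (adj a ||| 2 ^ a) == tab i)

/-- **The checker.** `c.check adj tab m vs P k = true` certifies: no `adj`-independent set of `k` listed vertices inside the mask `P`
(`Cert.sound`, given `tabOK adj tab m n`). [folklore] -/
def Cert.check (adj tab : ℕ → ℕ) (m : ℕ) (vs : List ℕ) : Cert → ℕ → ℕ → Bool
  | cov L, P, k => decide (L.length < k) && L.all (· < m) && (P &&& covMask tab L == P)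
  | fcov D L, P, k =>
      decide (wsum L < k * D) && L.all (fun iw => iw.1 < m) && vs.all fun v => !P.testBit v || decide (D ≤ wdeg tab v L)
  | br _ _ _, _, 0 => false
  | br v cin cout, P, k + 1 =>
      P.testBit v && cin.check adj tab m vs ((P.ldiff (adj v)).ldiff (2 ^ v)) k && cout.check adj tab m vs (P.ldiff (2 ^ v)) (k + 1)
  | auto, P, k => mcq adj vs k P

/-! ## Soundness of the certificate checker -/

section CertSound

variable {adj tab : ℕ → ℕ} {m n : ℕ} {vs : List ℕ}

/-- A sound table lists weak cliques. [folklore] -/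
theorem weakClique_of_tabOK (h : tabOK adj tab m n = true) {i : ℕ} (hi : i < m) : WeakClique adj (tab i) := by
  intro a b ha hb hab
  simp only [tabOK, List.all_eq_true, List.mem_range, Bool.and_eq_true, decide_eq_true_eq] at h
  obtain ⟨hlt, hall⟩ := h i hi
  have han : a < n := by
    by_contra hna
    have h2 : tab i < 2 ^ a := lt_of_lt_of_le hlt (Nat.pow_le_pow_right (by decide) (not_lt.1 hna))
    rw [Nat.testBit_lt_two_pow h2] at ha
    exact Bool.false_ne_true ha
  have hsub := hall a han
  rw [ha] at hsub
  simp only [Bool.not_true, Bool.false_or, beq_iff_eq] at hsub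
  have h3 := congrArg (fun x => x.testBit b) hsub
  simp only [Nat.testBit_land, hb, Bool.true_and, Nat.testBit_lor, Nat.testBit_two_pow, Bool.or_eq_true,
    decide_eq_true_eq] at h3
  rcases h3 with h3 | h3
  · exact Or.inl h3
  · exact absurd h3 hab

/-- Membership in the union of the listed cliques. [folklore] -/
theorem exists_of_covMask_testBit (tab : ℕ → ℕ) :
    ∀ (L : List ℕ) (a : ℕ), (covMask tab L).testBit a = true → ∃ i ∈ L, (tab i).testBit a = true
  | [], a, h => by simp [covMask] at h
  | i :: L, a, h => by
      simp only [covMask, Nat.testBit_lor, Bool.or_eq_true] at h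
      rcases h with h | h
      · exact ⟨i, by simp, h⟩
      · obtain ⟨j, hj, hja⟩ := exists_of_covMask_testBit tab L a h
        exact ⟨j, by simp [hj], hja⟩

/-- Double counting for a weighted clique list: the vertex-side sum of `wdeg` equals the clique-side sum of
weight × (number of members of `I` in the clique). [folklore] -/
theorem sum_wdeg_eq (tab : ℕ → ℕ) (I : Finset ℕ) :
    ∀ L : List (ℕ × ℕ), ∑ a ∈ I, wdeg tab a L = wsum (L.map fun iw => (iw.1, iw.2 * (I.filter fun a => (tab iw.1).testBit a = true).card))
  | [] => by simp [wdeg, wsum]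
  | iw :: L => by
      simp only [wdeg, wsum, List.map_cons, Finset.sum_add_distrib, sum_wdeg_eq tab I L]
      congr 1
      rw [← Finset.sum_filter, Finset.sum_const_nat fun _ _ => rfl, Nat.mul_comm]


/-- The clique-side sum is at most the total weight when `I` meets every listed clique at most once. [folklore] -/
theorem wsum_map_le (tab : ℕ → ℕ) (I : Finset ℕ) :
    ∀ L : List (ℕ × ℕ), (∀ iw ∈ L, (I.filter fun a => (tab iw.1).testBit a = true).card ≤ 1) →
      wsum (L.map fun iw => (iw.1, iw.2 * (I.filter fun a => (tab iw.1).testBit a = true).card)) ≤ wsum L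
  | [], _ => by simp [wsum]
  | iw :: L, h => by
      simp only [wsum, List.map_cons]
      have h1 := h iw (by simp)
      have h2 := wsum_map_le tab I L fun iw' hiw' => h iw' (by simp [hiw'])
      have : iw.2 * (I.filter fun a => (tab iw.1).testBit a = true).card ≤ iw.2 := by
        calc iw.2 * _ ≤ iw.2 * 1 := Nat.mul_le_mul_left _ h1
          _ = iw.2 := Nat.mul_one _
      omega

/-- **Soundness of the certificate checker.** [folklore] -/
theorem Cert.sound (htab : tabOK adj tab m n = true) :
    ∀ (c : Cert) (P k : ℕ), c.check adj tab m vs P k = true →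
      ∀ I : Finset ℕ, IndepN adj I → (∀ a ∈ I, a ∈ vs ∧ P.testBit a = true) → I.card < k
  | cov L, P, k, h, I, hI, hsub => by
      simp only [Cert.check, Bool.and_eq_true, decide_eq_true_eq, List.all_eq_true, beq_iff_eq] at h
      obtain ⟨⟨hlen, hidx⟩, hcov⟩ := h
      have hle : I.card ≤ (L.map tab).length := by
        refine hI.card_le_length (L.map tab) (fun B hB => ?_) fun a ha => ?_
        · obtain ⟨i, hi, rfl⟩ := List.mem_map.1 hB
          exact weakClique_of_tabOK htab (hidx i hi)
        · have hPa := (hsub a ha).2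
          have : (covMask tab L).testBit a = true := by
            have := congrArg (fun x => x.testBit a) hcov
            simp only [Nat.testBit_land, hPa, Bool.true_and] at this
            exact this
          obtain ⟨i, hi, hia⟩ := exists_of_covMask_testBit tab L a this
          exact ⟨tab i, List.mem_map.2 ⟨i, hi, rfl⟩, hia⟩
      rw [List.length_map] at hle
      omega
  | fcov D L, P, k, h, I, hI, hsub => by
      simp only [Cert.check, Bool.and_eq_true, decide_eq_true_eq, List.all_eq_true, Bool.or_eq_true, Bool.not_eq_true'] at h
      obtain ⟨⟨hsumlt, hidx⟩, hdeg⟩ := h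
      -- vertex side: every member of `I` carries weight ≥ D
      have hlow : D * I.card ≤ ∑ a ∈ I, wdeg tab a L := by
        rw [Nat.mul_comm, ← Finset.sum_const_nat (s := I) (f := fun _ => D) fun _ _ => rfl]
        refine Finset.sum_le_sum fun a ha => ?_
        obtain ⟨hav, hPa⟩ := hsub a ha
        rcases hdeg a hav with h0 | h0
        · rw [hPa] at h0; exact absurd h0 (by simp)
        · exact h0
      -- clique side: each listed clique meets `I` at most once
      have hup : ∑ a ∈ I, wdeg tab a L ≤ wsum L := by
        rw [sum_wdeg_eq]
        exact wsum_map_le tab I L fun iw hiw => hI.card_filter_le_one (weakClique_of_tabOK htab (hidx iw hiw))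
      have : D * I.card < k * D := lt_of_le_of_lt (hlow.trans hup) hsumlt
      rw [Nat.mul_comm k] at this
      exact Nat.lt_of_mul_lt_mul_left this
  | br v cin cout, P, 0, h, _, _, _ => by simp [Cert.check] at h
  | br v cin cout, P, k + 1, h, I, hI, hsub => by
      classical
      simp only [Cert.check, Bool.and_eq_true] at h
      obtain ⟨⟨-, hin⟩, hout⟩ := h
      by_cases hvI : v ∈ I
      · have hrest : (I.erase v).card < k := by
          refine Cert.sound htab cin _ k hin (I.erase v) (fun a ha b hb hab =>
            hI a (Finset.mem_of_mem_erase ha) b (Finset.mem_of_mem_erase hb) hab) fun a ha => ?_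
          have hav : a ≠ v := Finset.ne_of_mem_erase ha
          have haI := Finset.mem_of_mem_erase ha
          refine ⟨(hsub a haI).1, ?_⟩
          rw [Nat.testBit_ldiff, Nat.testBit_ldiff, Nat.testBit_two_pow, (hsub a haI).2, hI v hvI a haI (Ne.symm hav)]
          simp [Ne.symm hav]
        have := Finset.card_erase_add_one hvI
        omega
      · refine Cert.sound htab cout _ (k + 1) hout I hI fun a ha => ⟨(hsub a ha).1, ?_⟩
        have hav : a ≠ v := fun e => hvI (e ▸ ha)
        rw [Nat.testBit_ldiff, Nat.testBit_two_pow, (hsub a ha).2]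
        simp [Ne.symm hav]
  | auto, P, k, h, I, hI, hsub => card_lt_of_mcq adj vs k P h I hI hsub

end CertSound

end Summit.MatrixMultiplication.OmegaCensus.IndepSearch
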